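import Summits.Langlands.Langlands.Theorems.QuadraticWindowHostInducedRepPaneDefs
import Literature.NumberTheory.Automorphic.AsaiSignCont

/-!
# The member conclusion in the continuation-form currency (line `one-transparent-pane`, crux
# `Summit.Langlands.Langlands.Theses.QuadraticWindow.HostInducedRep`, stmt-Langlands-10902)

`MemberPkg` (`…PaneDefs.lean`) records the standard Asai sign of the member representation `τ'` as the
RAW partial-Euler-product pole `HasAsaiSign (complexConj K) 1`; its only consumer is the
Fakhruddin–Pilloni fact (Thm. 9.10), and its producer is the pane law.  In the raw currency the pane
law needs a Ramanujan-strength hypothesis on raw products (typed hazard, `Disproof.lean` §13 of the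
crux directory; `AsaiSignContinuation.lean`).  `MemberPkgCont` is the same statement with the sign
rendered by `HasAsaiSignCont` (`AsaiSignCont.lean`), the currency in which Mok's pole dichotomy
(`Mok2014_partialAsaiL_continuation_pole_dichotomy`) and Fakhruddin–Pilloni 9.10
(`FakhruddinPilloni2021_galoisRep_of_weaklyRegular_oddCont`) are both stated; the `_cont` variants of
the member / family / Galois stubs use it and need no raw-product hypothesis.
[folklore]
-/

open scoped BigOperators Polynomial Classical
open Filter Polynomial IsDedekindDomain NumberField
open Literature.NumberTheory.Automorphic Literature.NumberTheory.GaloisRepresentations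

-- `Summit.Langlands.Langlands.…` (summit = sub-problem name, D-0017 layout) trips `dupNamespace`.
set_option linter.dupNamespace false

noncomputable section

namespace Summit.Langlands.Langlands.Theorems.HostInducedRep.OneTransparentPane

section Member

variable (F₀ : Type) {F : Type} [Field F₀] [NumberField F₀] [Field F] [NumberField F] [Algebra F₀ F]

/-- **The member conclusion, continuation-form currency** for a CM quadratic `K/F₀`: a level
structure, a cuspidal `τ'` on `GL_{2n}/K`, an infinity type `T` and a Hecke character `ψ₁` with the six
properties consumed by `stub_galoisOverK_cont` (`HasInfinityType`, `IsCAlgebraic`, `IsWeaklyRegular`,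
conjugate self-duality a.e. and standard Asai sign w.r.t. `complexConj K` in the CONTINUATION form
`HasAsaiSignCont`, `ψ₁` algebraic) and the dictionary `MemberDict`.  Verbatim `MemberPkg` with
`HasAsaiSign` replaced by `HasAsaiSignCont`.  Names a statement; asserts nothing. [folklore] -/
def MemberPkgCont {n : ℕ} {hcpt : isCompact_glFiniteIntegralLevel n F}
    (π : CuspidalAutomorphicRepData n F hcpt) {ℓ : ℕ} [Fact ℓ.Prime] (ι : PadicAlgCl ℓ ≃+* ℂ)
    (eψ : FramedGaloisRep F ℂ 1) (K : Type) [Field K] [NumberField K] [Algebra F₀ K]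
    [IsCMField K] : Prop :=
  ∃ (hK : isCompact_glFiniteIntegralLevel (2 * n) K) (τ' : CuspidalAutomorphicRepData (2 * n) K hK)
    (T : InfinityType K (2 * n)) (ψ₁ : HeckeCharacter K),
    τ'.1.HasInfinityType T ∧ T.IsCAlgebraic ∧ T.IsWeaklyRegular ∧
    τ'.1.IsConjSelfDualAE (IsCMField.complexConj K) ∧
    τ'.1.HasAsaiSignCont (IsCMField.complexConj K) 1 ∧ ψ₁.IsAlgebraic ∧ MemberDict F₀ π ι eψ τ'.1 ψ₁

end Member

/-- Anchor of this definitions file (registered helper of the crux item): a member package in the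
continuation-form currency carries a conjugate self-dual cuspidal `τ'` whose continued Asai
`L`-function of sign `(-1)^{2n+1} = -1`, i.e. `As^{(-1)^{2n-1}}`, has its pole at `1`
(`HasAsaiSignCont … 1` unfolded). [folklore] -/
theorem paneDefsCont_anchor : ∀ (F₀ F : Type) [Field F₀] [NumberField F₀] [Field F] [NumberField F] [Algebra F₀ F] (n : ℕ) (hcpt : isCompact_glFiniteIntegralLevel n F) (π : CuspidalAutomorphicRepData n F hcpt) (ℓ : ℕ) [Fact ℓ.Prime] (ι : PadicAlgCl ℓ ≃+* ℂ) (eψ : FramedGaloisRep F ℂ 1) (K : Type) [Field K] [NumberField K] [Algebra F₀ K] [IsCMField K], MemberPkgCont F₀ π ι eψ K → ∃ (hK : isCompact_glFiniteIntegralLevel (2 * n) K) (τ' : CuspidalAutomorphicRepData (2 * n) K hK), τ'.1.IsConjSelfDualAE (IsCMField.complexConj K) ∧ τ'.1.HasAsaiPoleCont (IsCMField.complexConj K) ((-1) ^ (2 * n + 1) * 1) := by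
  intro F₀ F _ _ _ _ _ n hcpt π ℓ _ ι eψ K _ _ _ _ h
  obtain ⟨hK, τ', T, ψ₁, -, -, -, hcsd, hsign, -, -⟩ := h
  exact ⟨hK, τ', hcsd, hsign⟩

end Summit.Langlands.Langlands.Theorems.HostInducedRep.OneTransparentPane

end
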